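import Summits.BirchSwinnertonDyer.BirchSwinnertonDyer.Theorems.ThetaPartnerAtTwoSignedControlAtTwoPlusKimOfPrintKummer
import Summits.BirchSwinnertonDyer.BirchSwinnertonDyer.Theorems.ByReductionTypeAtTwoSupersingularFlatLocalZpGen
import Literature.NumberTheory.EllipticCurves.IwasawaSelmerControlCokerProofs
import Literature.NumberTheory.EllipticCurves.IwasawaSelmerControlLocalInputsProofs
import Literature.NumberTheory.EllipticCurves.IwasawaSelmerSupersingularLocalProofs
import Literature.NumberTheory.EllipticCurves.SelmerCorankProofs
import HarnessLib

/-!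
# The `±`-local lift at a place above `p` from a SHIFT datum: Greenberg's Lemma 3.2 over the LOCAL `ℤ_p`-extension
# `K_∞·K_v/K_v` with coefficients `E(K̄_v)[p^∞]`, and the descent of `loc_v y = x_w` to the Kummer condition cut out
# by a subgroup `A ≤ E(K_∞·K_v)` — KIM⁺ series part 7 (LOC engine, first half)

Route `ThetaPartnerAtTwo` (TP2; crux shared with `ResidualThetaTransportAtTwo`), crux K4 `SignedControlAtTwo`
(stmt-BirchSwinnertonDyer-20309), line `eulerchar` v4, stub `stub_plusKimNoFiniteSubmoduleTwo` (KIM⁺@2) and its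
READ-AT-2 residue LOC⁺@2 (parts 4–6). Seat `prover-bsd-wall-tp2-p3-w2` (width seat 2/3). Parts 7–8 prove the LOC
ENGINE: the level-`∞` Kummer form of LOC^ε@2 (hypothesis `hlocK` of part 6's door) FOLLOWS from ONE elementwise
statement about ONE `Γ_{ℚ₂}`-module `M = E(ℚ_{2,∞})` with Kobayashi's filtration `A = ⋃ₙ E^ε(ℚ_{2,n})`:
(DIV_A) «for `x ∈ A`, `k ∈ ℕ` there are `y ∈ A`, `j`, `w ∈ M` with `p^j x − p^k (g y − y) = p^{j+k} w`», i.e. the image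
of `A ⊗ ℚ_p/ℤ_p` in `M ⊗ ℚ_p/ℤ_p` is `(g − 1)`-divisible = `(E^ε_∞ ⊗ ℚ_p/ℤ_p)_Γ = 0` — the COINVARIANT twin of the
sibling seat w3's INVARIANT statement (LIFT_A) behind INJ⁺@2 (`…SignedLocalInjEngine`, `…PlusLocalInjOfLift`). At odd
`p` both follow from `(E^±(k_∞) ⊗ ℚ_p/ℤ_p)^∨ ≅ Λ` (B. D. Kim 2013 Props. 2.2–2.3; Kitajima–Otsuki 2018 Prop. 1.5).

THIS FILE (namespace `…Theorems.SignedEC`; any number field `K`, `W/K`, prime `p`, `ℤ_p`-extension `κ`, `K`-field `E`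
of characteristic `0` with its chosen embedding, `E(E) ≤ A ≤ E(K_∞·E)`, `g ∈ Γ_E` restricting to a topological
generator): `exists_localLift_kummer_of_shift` — from a cocycle `φ` of a class of `H¹(K_∞, E[p^∞])`, a point `S` with
`p^j S ∈ A` and a `p`-power-torsion `T` such that the shifted local values `f₁(τ) = ι φ(τ|) − (τS − S)` on
`G_∞ = Gal(K̄_E/K_∞·E)` satisfy `g • f₁(g⁻¹τg) − f₁(τ) = τT − T`, produce a `p`-power-torsion
`x_w ∈ H¹(Γ_E, E(K̄_E))` with «`loc_E y = x_w ⇒ [φ] − res y ∈ localKummerOverOfEmb W p (ker κ) (closureEmb E) A`».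
Steps: (B) `f₁` is a continuous cocycle on `G_∞` valued in the discrete `Γ_E`-module `E(K̄_E)[p^∞]` whose class is
fixed by `conj_g`; Greenberg's Lemma 3.2 for the local `ℤ_p`-extension (`SSFlatEC.exists_localZpExtension_of_isTopGenerator`,
`ZpExtension.mem_range_resOfLe_of_conjH1_eq`, `cd_p ℤ_p = 1`) extends it to a cocycle `B` on `Γ_E` up to a coboundary
`∂T₁`; (C) `x_w = [B]` is `p`-power torsion (compactness); (D) if `loc_E y = x_w` then `ι Y − B = ∂P` on `Γ_E` with
`p^n P ∈ E(E)` (uniform torsion bounds), and on `G_∞`, `ι(φ − Y|) = ∂(S − T₁ − P)` with `p^m (S − T₁ − P) ∈ A`.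
HONEST FRAMING: THEOREMS ONLY (no definition, no named fact, no `sorry`), route-independent; nothing about any curve
is asserted; closes no item; BSD is not proved by any of this.

References: [GreenbergLNM1716] §3 Lemma 3.2 (p. 86), §4 Lemma 4.7 (pp. 107–108); [BDKim2013] Props. 2.2–2.3, proof of
Cor. 3.15 (p. 199); [KitajimaOtsuki2018] Prop. 1.5; [SerreGaloisCohomology1997] I.§2.6, I.§5.8; [Kobayashi2003] Def. 1.1.
-/

set_option autoImplicit false
-- the Theorems namespace of this sub repeats the summit name by design (D-0017 nested layout)
set_option linter.dupNamespace false

noncomputable section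

open scoped Classical NumberField

open NumberField IsDedekindDomain

universe u

namespace Summit.BirchSwinnertonDyer.BirchSwinnertonDyer.Theorems.SignedEC

open Literature.NumberTheory.EllipticCurves Literature.NumberTheory.GaloisRepresentations
  WeierstrassCurve ZpExtension Literature.NumberTheory.EllipticCurves.Kobayashi2003
  Literature.NumberTheory.EllipticCurves.Sprung2012

variable {K : Type u} [Field K] [NumberField K] (W : WeierstrassCurve K) [W.IsElliptic] {p : ℕ} [Fact p.Prime]
  (κ : ZpExtension K p) (E : Type u) [Field E] [Algebra K E] [CharZero E]

omit [NumberField K] [W.IsElliptic] [Fact p.Prime] [CharZero E] in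
/-- Unpacking `loc_E [Y] = [X]` in `H¹(Γ_{E}, E(K̄_E))` (restriction to the decomposition group at the chosen
embedding, coefficients pushed along `E[p^∞] → E(K̄_E)`): the two cocycles differ by the coboundary of a point.
[cite: SerreGaloisCohomology1997, I.§2.4 and I.§5.1] -/
private theorem exists_point_of_localResOverOfEmb_eq (H : Subgroup (Field.absoluteGaloisGroup K))
    (ι : AlgebraicClosure K →ₐ[K] AlgebraicClosure E)
    (Y : contOneCocycles (discreteTopRep H (W.geomPrimaryTorsion p)))
    (X : contOneCocycles (discreteTopRep (localSubgroupOfEmb H ι) (localPoints W E)))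
    (h : W.localResOverOfEmb p H ι (oneCocycleClass _ Y) = oneCocycleClass _ X) :
    ∃ P : localPoints W E, ∀ u : localSubgroupOfEmb H ι,
      pointsMapOfEmb W ι ((Y.1 (resGalSubgroupOfEmb H ι u) : W.geomPrimaryTorsion p) : W.geomPoints) - X.1 u =
        (u : Field.absoluteGaloisGroup E) • P - P := by
  change (ContinuousCohomology.map (resGalSubgroupOfEmb H ι) (resHomOfEquivariant _ _ _) 1).hom
    (oneCocycleClass _ Y) = _ at h
  rw [map_oneCocycleClass, ← sub_eq_zero, ← oneCocycleClass_sub, oneCocycleClass_eq_zero_iff] at h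
  obtain ⟨P, hP⟩ := h
  refine ⟨P, fun u ↦ ?_⟩
  have h1 := hP u
  rw [Submodule.coe_sub, ContinuousMap.sub_apply, contOneCocycles.pullback_apply, discreteTopRep_ρ_apply,
    Subgroup.smul_def] at h1
  exact h1

omit [NumberField K] [W.IsElliptic] in
/-- **The local lift from a `g`-shift datum** (Steps B–D of the LOC engine): given a cocycle `φ` of a class of
`H¹(K_∞, E[p^∞])`, a point `S` with `p^j S ∈ A` and a `p`-power-torsion point `T` such that on `G_∞ = Gal(K̄_E/K_∞·E)` the
values `f₁(τ) = ι φ(τ|) − (τS − S)` satisfy `g • f₁(g⁻¹τg) − f₁(τ) = τT − T`, there is a `p`-power-torsion class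
`x_w ∈ H¹(Γ_E, E(K̄_E))` such that `loc_E y = x_w` forces `[φ] − res y` into the Kummer condition cut out by `A`
(`E(E) ≤ A ≤ E(K_∞·E)`). Greenberg's Lemma 3.2 is applied to the LOCAL `ℤ_p`-extension `K_∞·E/E` (tree
`SSFlatEC.exists_localZpExtension_of_isTopGenerator`, `ZpExtension.mem_range_resOfLe_of_conjH1_eq`) with coefficients
`E(K̄_E)[p^∞]`. [cite: GreenbergLNM1716, §3 Lemma 3.2 (p. 86) and §4 Lemma 4.7 (pp. 107–108)]
[cite: SerreGaloisCohomology1997, I.§2.6, I.§5.8] -/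
theorem exists_localLift_kummer_of_shift
    (A : AddSubgroup (localPoints W E))
    (hAM : A ≤ localTowerPointsOfEmb κ (closureEmb (K := K) E) W)
    (hA0 : localLayerPointsOfEmb κ (closureEmb (K := K) E) W 0 ≤ A)
    {g : Field.absoluteGaloisGroup E} (hg : κ.IsTopGenerator (resGal (K := K) E g))
    (φ : contOneCocycles (discreteTopRep κ.kerSubgroup (W.geomPrimaryTorsion p)))
    (S T : localPoints W E) (hSA : ∃ j : ℕ, p ^ j • S ∈ A) (hTt : ∃ n : ℕ, p ^ n • T = 0)
    (hshift : ∀ τ τ' : localSubgroupOfEmb κ.kerSubgroup (closureEmb (K := K) E),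
      (τ' : Field.absoluteGaloisGroup E) = g⁻¹ * τ * g →
      g • (pointsMapOfEmb W (closureEmb (K := K) E)
          ((φ.1 ⟨resGalOfEmb (closureEmb (K := K) E) τ', τ'.2⟩ : W.geomPrimaryTorsion p) : W.geomPoints) -
        ((τ' : Field.absoluteGaloisGroup E) • S - S)) -
      (pointsMapOfEmb W (closureEmb (K := K) E)
          ((φ.1 ⟨resGalOfEmb (closureEmb (K := K) E) τ, τ.2⟩ : W.geomPrimaryTorsion p) : W.geomPoints) -
        ((τ : Field.absoluteGaloisGroup E) • S - S)) = (τ : Field.absoluteGaloisGroup E) • T - T) :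
    ∃ xw : discreteH1 (localSubgroupOfEmb (⊤ : Subgroup (Field.absoluteGaloisGroup K)) (closureEmb (K := K) E))
        (localPoints W E),
      (∃ k : ℕ, p ^ k • xw = 0) ∧
      ∀ y : W.subgroupH1 p (⊤ : Subgroup (Field.absoluteGaloisGroup K)),
        W.localResOverOfEmb p ⊤ (closureEmb (K := K) E) y = xw →
        oneCocycleClass _ φ - W.resOfLe p (le_top : κ.kerSubgroup ≤ ⊤) y ∈
          localKummerOverOfEmb W p κ.kerSubgroup (closureEmb (K := K) E) A := by
  -- notation and generalities
  set ι : AlgebraicClosure K →ₐ[K] AlgebraicClosure E := closureEmb (K := K) E with hι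
  set M : AddSubgroup (localPoints W E) := localTowerPointsOfEmb κ ι W with hM
  have hMfix : ∀ {P : localPoints W E}, P ∈ M →
      ∀ τ : Field.absoluteGaloisGroup E, τ ∈ localSubgroupOfEmb κ.kerSubgroup ι → τ • P = P :=
    fun {P} hP ↦ (mem_localTowerPointsOfEmb_iff κ ι W P).1 hP
  have hconj : ∀ (σ τ : Field.absoluteGaloisGroup E), τ ∈ localSubgroupOfEmb κ.kerSubgroup ι →
      σ⁻¹ * τ * σ ∈ localSubgroupOfEmb κ.kerSubgroup ι := by
    intro σ τ hτ
    rw [mem_localSubgroupOfEmb_iff] at hτ ⊢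
    rw [map_mul, map_mul, map_inv]
    exact κ.kerSubgroup_normal.conj_mem' _ hτ _
  have hGmem : ∀ {u : Field.absoluteGaloisGroup E}, u ∈ localSubgroupOfEmb κ.kerSubgroup ι →
      resGalOfEmb ι u ∈ κ.kerSubgroup := fun {u} hu ↦ (mem_localSubgroupOfEmb_iff _ ι u).1 hu
  have hγ : resGal (K := K) E g = resGalOfEmb ι g := rfl
  -- the local values `f0` of `φ` on `G_∞ = Gal(K̄_E/K_∞·E)`
  obtain ⟨f0, hf0⟩ : ∃ f0 : ∀ u : Field.absoluteGaloisGroup E, u ∈ localSubgroupOfEmb κ.kerSubgroup ι →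
      localPoints W E, ∀ u hu, f0 u hu =
      pointsMapOfEmb W ι ((φ.1 ⟨resGalOfEmb ι u, hGmem hu⟩ : W.geomPrimaryTorsion p) : W.geomPoints) :=
    ⟨_, fun _ _ ↦ rfl⟩
  have hf0mul : ∀ (σ τ : Field.absoluteGaloisGroup E) (hσ : σ ∈ localSubgroupOfEmb κ.kerSubgroup ι)
      (hτ : τ ∈ localSubgroupOfEmb κ.kerSubgroup ι),
      f0 (σ * τ) (mul_mem hσ hτ) = f0 σ hσ + σ • f0 τ hτ := by
    intro σ τ hσ hτ
    have hst : (⟨resGalOfEmb ι (σ * τ), hGmem (mul_mem hσ hτ)⟩ : κ.kerSubgroup) =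
        ⟨resGalOfEmb ι σ, hGmem hσ⟩ * ⟨resGalOfEmb ι τ, hGmem hτ⟩ := Subtype.ext (map_mul _ _ _)
    have h := φ.2 ⟨resGalOfEmb ι σ, hGmem hσ⟩ ⟨resGalOfEmb ι τ, hGmem hτ⟩
    rw [hf0 (σ * τ) (mul_mem hσ hτ), hf0 σ hσ, hf0 τ hτ, hst, h, AddSubgroup.coe_add, map_add,
      discreteTopRep_ρ_apply, Subgroup.smul_def, primaryComponent.coe_smul, pointsMapOfEmb_smul]
  have hf0tors : ∀ u hu, ∃ N : ℕ, p ^ N • f0 u hu = 0 := fun u hu ↦ by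
    obtain ⟨N, hN⟩ := AddCommGroup.mem_primaryComponent.mp (φ.1 ⟨resGalOfEmb ι u, hGmem hu⟩).2
    refine ⟨N, ?_⟩
    rw [hf0 u hu, ← map_nsmul, hN, map_zero]
  -- the modified local values `f1 τ = f0 τ − (τ S − S)` on `G_∞`
  have hgconj_mem : ∀ {τ : Field.absoluteGaloisGroup E}, τ ∈ localSubgroupOfEmb κ.kerSubgroup ι →
      g⁻¹ * τ * g ∈ localSubgroupOfEmb κ.kerSubgroup ι := fun {τ} hτ ↦ hconj g τ hτ
  obtain ⟨j, hjS⟩ := hSA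
  have hSfix : ∀ {τ : Field.absoluteGaloisGroup E}, τ ∈ localSubgroupOfEmb κ.kerSubgroup ι →
      p ^ j • (τ • S - S) = 0 := fun {τ} hτ ↦ by
    rw [smul_sub, smul_comm (p ^ j) τ S, hMfix (hAM hjS) τ hτ, sub_self]
  -- (i) `p`-power torsion
  have hf1tors : ∀ (τ : Field.absoluteGaloisGroup E) (hτ : τ ∈ localSubgroupOfEmb κ.kerSubgroup ι),
      ∃ N : ℕ, p ^ N • (f0 τ hτ - (τ • S - S)) = 0 := by
    intro τ hτ
    obtain ⟨N, hN⟩ := hf0tors τ hτ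
    refine ⟨N + j, ?_⟩
    rw [smul_sub, pow_add, mul_comm, mul_smul, hN, smul_zero, mul_comm, mul_smul, hSfix hτ, smul_zero,
      sub_zero]
  -- (ii) cocycle identity
  have hf1mul : ∀ (σ τ : Field.absoluteGaloisGroup E) (hσ : σ ∈ localSubgroupOfEmb κ.kerSubgroup ι)
      (hτ : τ ∈ localSubgroupOfEmb κ.kerSubgroup ι),
      f0 (σ * τ) (mul_mem hσ hτ) - ((σ * τ) • S - S) =
        (f0 σ hσ - (σ • S - S)) + σ • (f0 τ hτ - (τ • S - S)) := by
    intro σ τ hσ hτ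
    rw [hf0mul σ τ hσ hτ, mul_smul, smul_sub, smul_sub]
    abel
  -- (iii) `g`-invariance up to the coboundary of the torsion point `T` (the displayed shift datum)
  have hf1conj : ∀ (τ : Field.absoluteGaloisGroup E) (hτ : τ ∈ localSubgroupOfEmb κ.kerSubgroup ι),
      g • (f0 (g⁻¹ * τ * g) (hgconj_mem hτ) - ((g⁻¹ * τ * g) • S - S)) - (f0 τ hτ - (τ • S - S)) =
        τ • T - T := by
    intro τ hτ
    rw [hf0 _ (hgconj_mem hτ), hf0 τ hτ]
    exact hshift ⟨τ, hτ⟩ ⟨g⁻¹ * τ * g, hgconj_mem hτ⟩ rfl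
  -- Step B: the local `ℤ_p`-extension `κ_E` (kernel `G_∞`, generator `g`) and Greenberg's Lemma 3.2 over `E`
  obtain ⟨κE, hker, hgE⟩ := SSFlatEC.exists_localZpExtension_of_isTopGenerator κ E hg
  have hmemE : ∀ {τ : Field.absoluteGaloisGroup E}, τ ∈ κE.kerSubgroup →
      τ ∈ localSubgroupOfEmb κ.kerSubgroup ι := fun {τ} hτ ↦ by rw [hker] at hτ; exact hτ
  have hmemE' : ∀ {τ : Field.absoluteGaloisGroup E}, τ ∈ localSubgroupOfEmb κ.kerSubgroup ι →
      τ ∈ κE.kerSubgroup := fun {τ} hτ ↦ by rw [hker]; exact hτ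
  -- the `p`-primary torsion `𝒯 = E(K̄_E)[p^∞]` as a discrete `Γ_E`-module
  set 𝒯 : AddSubgroup (localPoints W E) := AddCommGroup.primaryComponent (localPoints W E) p with h𝒯
  have hprim : ∀ m : 𝒯, ∃ n : ℕ, p ^ n • m = 0 := fun m ↦ by
    obtain ⟨n, hn⟩ := AddCommGroup.mem_primaryComponent.mp m.2
    exact ⟨n, Subtype.ext (by rw [AddSubmonoidClass.coe_nsmul, hn, ZeroMemClass.coe_zero])⟩
  have hcont : ∀ m : 𝒯, Continuous fun σ : Field.absoluteGaloisGroup E ↦ σ • m := fun m ↦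
    continuous_induced_rng.2 (continuous_smul_localPoints W E (m : localPoints W E))
  -- the modified cocycle `F1 = f0 − ∂S` on `κ_E.ker = G_∞`, valued in `𝒯`
  have hF1mem : ∀ τ : κE.kerSubgroup,
      f0 τ.1 (hmemE τ.2) - ((τ : Field.absoluteGaloisGroup E) • S - S) ∈ 𝒯 := fun τ ↦
    AddCommGroup.mem_primaryComponent.mpr (hf1tors τ.1 (hmemE τ.2))
  obtain ⟨F1fun, hF1val⟩ : ∃ F : κE.kerSubgroup → 𝒯, ∀ τ : κE.kerSubgroup, (F τ : localPoints W E) =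
      f0 τ.1 (hmemE τ.2) - ((τ : Field.absoluteGaloisGroup E) • S - S) :=
    ⟨fun τ ↦ ⟨_, hF1mem τ⟩, fun _ ↦ rfl⟩
  have hF1cont : Continuous F1fun := by
    refine continuous_induced_rng.2 ?_
    have hfun : (Subtype.val ∘ F1fun) = fun τ : κE.kerSubgroup ↦
        pointsMapOfEmb W ι ((φ.1 ⟨resGalOfEmb ι τ.1, hGmem (hmemE τ.2)⟩ : W.geomPrimaryTorsion p) :
          W.geomPoints) - ((τ : Field.absoluteGaloisGroup E) • S - S) := by
      funext τ
      rw [Function.comp_apply, hF1val, hf0]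
    rw [hfun]
    refine Continuous.sub ?_ (((continuous_smul_localPoints W E S).comp continuous_subtype_val).sub
      continuous_const)
    have h1 : Continuous fun τ : κE.kerSubgroup ↦
        (⟨resGalOfEmb ι τ.1, hGmem (hmemE τ.2)⟩ : κ.kerSubgroup) :=
      ((map_continuous (resGalOfEmb ι)).comp continuous_subtype_val).subtype_mk _
    exact (continuous_of_discreteTopology (α := W.geomPrimaryTorsion p)
      (f := fun x ↦ pointsMapOfEmb W ι (x : W.geomPoints))).comp (φ.1.continuous.comp h1)
  have hF1coc : ∀ a b : κE.kerSubgroup,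
      F1fun (a * b) = F1fun a + (a : Field.absoluteGaloisGroup E) • F1fun b := by
    intro a b
    apply Subtype.ext
    rw [AddSubgroup.coe_add, primaryComponent.coe_smul, hF1val, hF1val, hF1val]
    exact hf1mul a.1 b.1 (hmemE a.2) (hmemE b.2)
  let F1 : contOneCocycles (discreteTopRep κE.kerSubgroup 𝒯) := ⟨⟨F1fun, hF1cont⟩, fun a b ↦ hF1coc a b⟩
  have hF1app : ∀ τ : κE.kerSubgroup, (F1.1 τ : localPoints W E) =
      f0 τ.1 (hmemE τ.2) - ((τ : Field.absoluteGaloisGroup E) • S - S) := fun τ ↦ hF1val τ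
  -- `[F1]` is fixed by `conj_g` (the torsion point `T`)
  have hTmem : T ∈ 𝒯 := AddCommGroup.mem_primaryComponent.mpr hTt
  have hx : Literature.NumberTheory.EllipticCurves.conjH1 κE.kerSubgroup 𝒯 (g ^ p ^ 0)
      (oneCocycleClass _ F1) = oneCocycleClass _ F1 := by
    rw [pow_zero, pow_one]
    have hc : Literature.NumberTheory.EllipticCurves.conjH1 κE.kerSubgroup 𝒯 g (oneCocycleClass _ F1) =
        oneCocycleClass _ (contOneCocycles.pullback (subgroupConj κE.kerSubgroup g)
          (resHomOfEquivariant (subgroupConj κE.kerSubgroup g) (DistribSMul.toAddMonoidHom 𝒯 g)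
            (ZpExtension.conj_compat κE.kerSubgroup g)) F1) :=
      map_oneCocycleClass _ _ _ F1
    rw [hc, ← sub_eq_zero, ← oneCocycleClass_sub, oneCocycleClass_eq_zero_iff]
    refine ⟨⟨T, hTmem⟩, fun τ ↦ Subtype.ext ?_⟩
    rw [Submodule.coe_sub, ContinuousMap.sub_apply, contOneCocycles.pullback_apply, discreteTopRep_ρ_apply,
      Subgroup.smul_def, AddSubgroup.coe_sub, AddSubgroup.coe_sub, primaryComponent.coe_smul]
    change g • (F1.1 (subgroupConj κE.kerSubgroup g τ) : localPoints W E) - (F1.1 τ : localPoints W E) =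
      (τ : Field.absoluteGaloisGroup E) • T - T
    have hsc : (subgroupConj κE.kerSubgroup g τ : κE.kerSubgroup) =
        ⟨g⁻¹ * τ * g, hmemE' (hgconj_mem (hmemE τ.2))⟩ := Subtype.ext (subgroupConj_apply_coe _ _ _)
    rw [hsc, hF1app, hF1app]
    exact hf1conj τ.1 (hmemE τ.2)
  -- Greenberg's Lemma 3.2 for `κ_E`, layer `0`: `[F1] = res b`, `b` a class on `Γ_E = κ_E⁻¹(p⁰ℤ_p)`
  obtain ⟨b, hb⟩ := ZpExtension.mem_range_resOfLe_of_conjH1_eq κE hgE 0 hcont hprim (oneCocycleClass _ F1) hx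
  obtain ⟨B, rfl⟩ := oneCocycleClass_surjective _ b
  have hresB : Literature.NumberTheory.EllipticCurves.resOfLe 𝒯 (κE.kerSubgroup_le_layerSubgroup 0)
      (oneCocycleClass _ B) =
      oneCocycleClass _ (contOneCocycles.pullback (subgroupInclusion (κE.kerSubgroup_le_layerSubgroup 0))
        (resHomOfEquivariant (subgroupInclusion (κE.kerSubgroup_le_layerSubgroup 0))
          (AddMonoidHom.id 𝒯) (fun _ _ ↦ rfl)) B) :=
    map_oneCocycleClass _ _ _ B
  rw [hresB, ← sub_eq_zero, ← oneCocycleClass_sub, oneCocycleClass_eq_zero_iff] at hb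
  obtain ⟨T₁, hT₁⟩ := hb
  have hB1 : ∀ τ : κE.kerSubgroup,
      (B.1 ⟨(τ : Field.absoluteGaloisGroup E), κE.kerSubgroup_le_layerSubgroup 0 τ.2⟩ : localPoints W E) -
        (F1.1 τ : localPoints W E) = (τ : Field.absoluteGaloisGroup E) • (T₁ : localPoints W E) - T₁ := by
    intro τ
    have h1 := congrArg (fun z : 𝒯 ↦ (z : localPoints W E)) (hT₁ τ)
    simp only at h1
    rw [Submodule.coe_sub, ContinuousMap.sub_apply, contOneCocycles.pullback_apply, discreteTopRep_ρ_apply,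
      Subgroup.smul_def, AddSubgroup.coe_sub, AddSubgroup.coe_sub, primaryComponent.coe_smul] at h1
    exact h1
  -- uniform torsion bound for the values of `B` (compactness of `Γ_E`)
  haveI : CompactSpace (Field.absoluteGaloisGroup E) := absoluteGaloisGroup_compactSpace E
  haveI : CompactSpace (κE.layerSubgroup 0) := isCompact_iff_compactSpace.mp
    (Subgroup.isClosed_of_isOpen _ (κE.isOpen_layerSubgroup 0)).isCompact
  obtain ⟨N₁, hN₁⟩ := exists_pow_smul_apply_eq_zero B.1 (fun u ↦ hprim (B.1 u))
  obtain ⟨a, ha⟩ : ∃ a : ℕ, p ^ a • (T₁ : localPoints W E) = 0 := AddCommGroup.mem_primaryComponent.mp T₁.2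
  -- Step C: the local class `x_w ∈ H¹(Γ_E, E(K̄_E))[p^∞]`
  have hu0 : ∀ u : Field.absoluteGaloisGroup E, u ∈ κE.layerSubgroup 0 := fun u ↦ by
    rw [ZpExtension.layerSubgroup_zero]; exact Subgroup.mem_top u
  obtain ⟨Xfun, hXval⟩ : ∃ X : localSubgroupOfEmb (⊤ : Subgroup (Field.absoluteGaloisGroup K)) ι →
      localPoints W E, ∀ u, X u = (B.1 ⟨(u : Field.absoluteGaloisGroup E), hu0 u⟩ : localPoints W E) :=
    ⟨_, fun _ ↦ rfl⟩
  have hXcont : Continuous Xfun := by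
    rw [show Xfun = fun u : localSubgroupOfEmb (⊤ : Subgroup (Field.absoluteGaloisGroup K)) ι ↦
      (B.1 ⟨(u : Field.absoluteGaloisGroup E), hu0 u⟩ : localPoints W E) from funext hXval]
    exact continuous_subtype_val.comp (B.1.continuous.comp (continuous_subtype_val.subtype_mk _))
  have hXcoc : ∀ u v : localSubgroupOfEmb (⊤ : Subgroup (Field.absoluteGaloisGroup K)) ι,
      Xfun (u * v) = Xfun u + (u : Field.absoluteGaloisGroup E) • Xfun v := by
    intro u v
    have huv : (⟨((u * v : localSubgroupOfEmb (⊤ : Subgroup (Field.absoluteGaloisGroup K)) ι) :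
        Field.absoluteGaloisGroup E), hu0 _⟩ : κE.layerSubgroup 0) =
        ⟨(u : Field.absoluteGaloisGroup E), hu0 u⟩ * ⟨(v : Field.absoluteGaloisGroup E), hu0 v⟩ := rfl
    rw [hXval, hXval, hXval, huv, B.2, AddSubgroup.coe_add, discreteTopRep_ρ_apply, Subgroup.smul_def,
      primaryComponent.coe_smul]
  let X : contOneCocycles (discreteTopRep (localSubgroupOfEmb (⊤ : Subgroup (Field.absoluteGaloisGroup K)) ι)
      (localPoints W E)) := ⟨⟨Xfun, hXcont⟩, fun u v ↦ hXcoc u v⟩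
  have hXapp : ∀ u, X.1 u = (B.1 ⟨(u : Field.absoluteGaloisGroup E), hu0 u⟩ : localPoints W E) :=
    fun u ↦ hXval u
  refine ⟨oneCocycleClass _ X, ⟨N₁, ?_⟩, fun y hy ↦ ?_⟩
  · -- `p^{N₁} x_w = 0`
    rw [← oneCocycleClassₗ_apply, ← map_nsmul, oneCocycleClassₗ_apply, oneCocycleClass_eq_zero_iff]
    refine ⟨0, fun u ↦ ?_⟩
    rw [AddSubmonoidClass.coe_nsmul, ContinuousMap.nsmul_apply, hXapp, ← AddSubmonoidClass.coe_nsmul, hN₁,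
      ZeroMemClass.coe_zero, map_zero, sub_zero]
  · -- Step D: `t − res y` is Kummer-from-`A`
    obtain ⟨Y, rfl⟩ := oneCocycleClass_surjective
      (discreteTopRep (⊤ : Subgroup (Field.absoluteGaloisGroup K)) (W.geomPrimaryTorsion p)) y
    -- unpack `loc_E y = x_w`: a point `P` with `ι Y(res u) − X u = u P − P`
    obtain ⟨P, hP⟩ := exists_point_of_localResOverOfEmb_eq W E ⊤ ι Y X hy
    have hP' : ∀ u : localSubgroupOfEmb (⊤ : Subgroup (Field.absoluteGaloisGroup K)) ι,
        pointsMapOfEmb W ι ((Y.1 (resGalSubgroupOfEmb ⊤ ι u) : W.geomPrimaryTorsion p) : W.geomPoints) -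
          (B.1 ⟨(u : Field.absoluteGaloisGroup E), hu0 u⟩ : localPoints W E) =
          (u : Field.absoluteGaloisGroup E) • P - P := fun u ↦ by rw [← hXapp u]; exact hP u
    -- uniform torsion bounds: `Y` on `Γ_K` (compact) and `B` on `Γ_E`; so `p^n P ∈ E(E) ≤ A`
    haveI : CompactSpace (Field.absoluteGaloisGroup K) := absoluteGaloisGroup_compactSpace K
    haveI : CompactSpace (⊤ : Subgroup (Field.absoluteGaloisGroup K)) := isCompact_iff_compactSpace.mp
      (Subgroup.isClosed_of_isOpen _ (by rw [Subgroup.coe_top]; exact isOpen_univ)).isCompact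
    have hYtors : ∀ h : (⊤ : Subgroup (Field.absoluteGaloisGroup K)), ∃ n : ℕ, p ^ n • Y.1 h = 0 := fun h ↦ by
      obtain ⟨n, hn⟩ := AddCommGroup.mem_primaryComponent.mp (Y.1 h).2
      exact ⟨n, Subtype.ext (by rw [AddSubmonoidClass.coe_nsmul, hn, ZeroMemClass.coe_zero])⟩
    obtain ⟨N₂, hN₂⟩ := exists_pow_smul_apply_eq_zero Y.1 hYtors
    have hPn : p ^ (N₁ + N₂) • P ∈ localLayerPointsOfEmb κ ι W 0 := by
      rw [mem_localLayerPointsOfEmb_zero_iff]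
      intro u
      have hu : u ∈ localSubgroupOfEmb (⊤ : Subgroup (Field.absoluteGaloisGroup K)) ι :=
        (mem_localSubgroupOfEmb_iff _ ι u).2 (Subgroup.mem_top _)
      have h1 := hP' ⟨u, hu⟩
      have key : ∀ b yv : localPoints W E, p ^ N₁ • b = 0 → p ^ N₂ • yv = 0 →
          yv - b = (u : Field.absoluteGaloisGroup E) • P - P →
          p ^ (N₁ + N₂) • ((u : Field.absoluteGaloisGroup E) • P - P) = 0 := by
        intro b yv hb hyv h
        rw [← h, smul_sub]
        have e1 : p ^ (N₁ + N₂) • yv = 0 := by rw [pow_add, mul_smul, hyv, smul_zero]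
        have e2 : p ^ (N₁ + N₂) • b = 0 := by rw [pow_add, mul_comm, mul_smul, hb, smul_zero]
        rw [e1, e2, sub_self]
      have h2 := key _ _ (by rw [← AddSubmonoidClass.coe_nsmul, hN₁, ZeroMemClass.coe_zero])
        (by rw [← map_nsmul, ← AddSubmonoidClass.coe_nsmul, hN₂, ZeroMemClass.coe_zero, map_zero]) h1
      rw [smul_sub, sub_eq_zero, smul_comm (p ^ (N₁ + N₂)) (u : Field.absoluteGaloisGroup E) P] at h2
      exact h2
    -- the Kummer point `Q″ = S − T₁ − P` and its exponent
    obtain ⟨Q₂, hQ₂⟩ : ∃ Q₂ : localPoints W E, Q₂ = S - (T₁ : localPoints W E) - P := ⟨_, rfl⟩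
    have hQ₂A : p ^ (j + a + (N₁ + N₂)) • Q₂ ∈ A := by
      have e1 : p ^ (j + a + (N₁ + N₂)) • S = p ^ (a + (N₁ + N₂)) • (p ^ j • S) := by
        rw [smul_smul, ← pow_add, show a + (N₁ + N₂) + j = j + a + (N₁ + N₂) from by omega]
      have e2 : p ^ (j + a + (N₁ + N₂)) • (T₁ : localPoints W E) = 0 := by
        rw [show j + a + (N₁ + N₂) = (j + (N₁ + N₂)) + a from by omega, pow_add, mul_smul, ha, smul_zero]
      have e3 : p ^ (j + a + (N₁ + N₂)) • P = p ^ (j + a) • (p ^ (N₁ + N₂) • P) := by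
        rw [smul_smul, ← pow_add]
      rw [hQ₂, smul_sub, smul_sub, e1, e2, e3, sub_zero]
      exact sub_mem (AddSubgroup.nsmul_mem _ hjS _) (AddSubgroup.nsmul_mem _ (hA0 hPn) _)
    -- `res y` at the cocycle level
    have hresY : W.resOfLe p (le_top : κ.kerSubgroup ≤ ⊤) (oneCocycleClass _ Y) =
        oneCocycleClass _ (contOneCocycles.pullback (subgroupInclusion (le_top : κ.kerSubgroup ≤ ⊤))
          (resHomOfEquivariant (subgroupInclusion (le_top : κ.kerSubgroup ≤ ⊤))
            (AddMonoidHom.id (W.geomPrimaryTorsion p)) (fun _ _ ↦ rfl)) Y) :=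
      map_oneCocycleClass _ _ _ Y
    rw [hresY, ← oneCocycleClass_sub]
    refine ⟨_, Q₂, j + a + (N₁ + N₂), rfl, hQ₂A, fun τ ↦ ?_⟩
    -- the local values of `φ − res Y` on `G_∞` are `∂Q₂`
    have hτ : (τ : Field.absoluteGaloisGroup E) ∈ localSubgroupOfEmb κ.kerSubgroup ι := τ.2
    have hτtop : (τ : Field.absoluteGaloisGroup E) ∈
        localSubgroupOfEmb (⊤ : Subgroup (Field.absoluteGaloisGroup K)) ι :=
      (mem_localSubgroupOfEmb_iff _ ι _).2 (Subgroup.mem_top _)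
    rw [Submodule.coe_sub, ContinuousMap.sub_apply, contOneCocycles.pullback_apply, AddSubgroup.coe_sub, map_sub]
    have e1 : pointsMapOfEmb W ι ((φ.1 (resGalSubgroupOfEmb κ.kerSubgroup ι τ) : W.geomPrimaryTorsion p) :
        W.geomPoints) = f0 τ.1 hτ := (hf0 τ.1 hτ).symm
    have e2 : pointsMapOfEmb W ι (((resHomOfEquivariant (subgroupInclusion (le_top : κ.kerSubgroup ≤ ⊤))
        (AddMonoidHom.id (W.geomPrimaryTorsion p)) (fun _ _ ↦ rfl)).hom
          (Y.1 (subgroupInclusion (le_top : κ.kerSubgroup ≤ ⊤) (resGalSubgroupOfEmb κ.kerSubgroup ι τ))) :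
        W.geomPrimaryTorsion p) : W.geomPoints) =
        pointsMapOfEmb W ι ((Y.1 (resGalSubgroupOfEmb ⊤ ι ⟨τ.1, hτtop⟩) : W.geomPrimaryTorsion p) :
          W.geomPoints) := rfl
    have e3 := hP' ⟨τ.1, hτtop⟩
    have e4 := hB1 ⟨τ.1, hmemE' hτ⟩
    have e5 := hF1app ⟨τ.1, hmemE' hτ⟩
    rw [e1, e2]
    -- bookkeeping: all classes of `B` at `τ` are the same element
    have eB : (B.1 ⟨((⟨τ.1, hτtop⟩ : localSubgroupOfEmb (⊤ : Subgroup (Field.absoluteGaloisGroup K)) ι) :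
        Field.absoluteGaloisGroup E), hu0 _⟩ : localPoints W E) =
        (B.1 ⟨((⟨τ.1, hmemE' hτ⟩ : κE.kerSubgroup) : Field.absoluteGaloisGroup E),
          κE.kerSubgroup_le_layerSubgroup 0 (⟨τ.1, hmemE' hτ⟩ : κE.kerSubgroup).2⟩ : localPoints W E) := rfl
    rw [eB] at e3
    rw [e5] at e4
    -- `f0 τ − ι Y(res τ) = τ Q₂ − Q₂`
    have e4' : f0 τ.1 hτ = (B.1 ⟨((⟨τ.1, hmemE' hτ⟩ : κE.kerSubgroup) : Field.absoluteGaloisGroup E),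
          κE.kerSubgroup_le_layerSubgroup 0 (⟨τ.1, hmemE' hτ⟩ : κE.kerSubgroup).2⟩ : localPoints W E) -
        ((τ : Field.absoluteGaloisGroup E) • (T₁ : localPoints W E) - T₁) +
        ((τ : Field.absoluteGaloisGroup E) • S - S) := by
      rw [← e4]; abel
    have e3' : pointsMapOfEmb W ι ((Y.1 (resGalSubgroupOfEmb ⊤ ι ⟨τ.1, hτtop⟩) :
        W.geomPrimaryTorsion p) : W.geomPoints) =
        (B.1 ⟨((⟨τ.1, hmemE' hτ⟩ : κE.kerSubgroup) : Field.absoluteGaloisGroup E),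
          κE.kerSubgroup_le_layerSubgroup 0 (⟨τ.1, hmemE' hτ⟩ : κE.kerSubgroup).2⟩ : localPoints W E) +
        ((τ : Field.absoluteGaloisGroup E) • P - P) := by
      rw [← e3]; abel
    rw [e4', e3', hQ₂, smul_sub, smul_sub]
    abel

end Summit.BirchSwinnertonDyer.BirchSwinnertonDyer.Theorems.SignedEC

end
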